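import Summits.BirchSwinnertonDyer.BirchSwinnertonDyer.Theorems.ResidualThetaTransportAtTwoThetaLayerLambdaCongruenceAtTwoSdTorsionShapiroCount
import Literature.NumberTheory.EllipticCurves.ModularSymbolsEichlerShimuraHoldsProofs
import Mathlib.LinearAlgebra.Complex.FiniteDimensional
import HarnessLib

/-!
# Crux Kan⁺ `ThetaLayerLambdaCongruenceAtTwo` (stmt-BirchSwinnertonDyer-20688), SD floor, brick S1 —
# parabolic–elliptic cocycles of `Γ₀(N)` over an arbitrary field, IV: the torsion Eichler–Shimura theorem
# (width seat bsd-wall-rtt-p3-w4 g6; `--supports stmt-BirchSwinnertonDyer-20688`; proofs only, no named fact, no `sorry`;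
# BSD is not proved by any of this)

MAIN THEOREM (`exists_addMonoidHom_periodHomology_eq`). Let `K` be ANY field and `N ≥ 1`. Every map
`u : Γ₀(N) → K` which is additive and vanishes on the parabolic and on the elliptic elements of `Γ₀(N)`
FACTORS THROUGH THE PERIOD MAP: there is an additive `φ : Λ → K` on the period homology
`Λ = periodHomology N = H₁(X₀(N), ℤ) ⊆ S₂(Γ₀(N))^∨` with `u(γ) = φ({∞, γ∞})` for all `γ ∈ Γ₀(N)`
(`{∞, γ∞} = periodFunctional N γ`). Equivalently: the kernel of Manin's surjection
`γ ↦ {∞, γ∞} : Γ₀(N) ↠ Λ` is invisible to every field — `Λ ⊗ K = (Γ₀(N)ᵃᵇ/⟨±1, elliptic, parabolic⟩) ⊗ K`,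
in particular `Λ/ℓΛ ≅ Γ₀(N)ᵃᵇ/⟨±1, ell, par⟩ ⊗ 𝔽_ℓ` for every prime `ℓ` (the integral content of
Manin's theorem `H₁(X₀(N), ℤ) ≅ Γ₀(N)ᵃᵇ/⟨ell, par⟩`, which the tree so far had only rationally).
Over `K = ℝ` this is the tree's Eichler–Shimura isomorphism count; the point is `char K = 2, 3`.

PROOF. (i) `γ ↦ (x ↦ ⌊i-th coordinate of {∞, γ∞}⌋)` for a `ℤ`-basis of `Λ` (the real basis `b` of
`S₂^∨` with `Λ = ℤb₁ ⊕ ⋯ ⊕ ℤb_n`, `periodHomology_eq_span_basis_holds`; `n = 2 dim_ℂ S₂(Γ₀(N))`) gives `n`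
parabolic–elliptic cocycles `K`-linearly independent (evaluate at `γ_j` with `{∞, γ_j∞} = b_j`); here
`{∞, γ∞} = 0` for elliptic `γ` (`periodFunctional_eq_zero_of_isElliptic`: `γ² = -1` or `γ³ = ∓1` by
Cayley–Hamilton, and `S₂^∨` is torsion-free) and for parabolic `γ` (tree). (ii) Part III:
`dim_K H ≤ 2 dim S₂ = n`. Hence these cocycles are a `K`-basis of `H`, and every `u ∈ H` is a
`K`-combination of coordinate functionals of `{∞, γ∞}`, i.e. factors through `Λ`.

RELATION TO THE PARALLEL RING VERSION (w2 g8, landed while this was written):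
`…Theorems.ThetaLayerLambdaCongruenceAtTwo.exists_addMonoidHom_periodHomology_of_cuspCharacter`
(`…ParabolicCharacterFactor`) proves the factorisation for additive `u : Γ₀(N) → R` into any `R` WITHOUT
`3`-TORSION, with the hypotheses phrased as "`u` kills the cusp stabilisers (`(k⁻¹γk)₁₀ = 0`) and the conjugates
of `S`" (order-`3` elliptics are then handled by dividing by `3`), by Manin's continued-fraction trick. The present
file is the FIELD version in EVERY characteristic (including `3`: the order-`3`/`6` elliptic elements are killed by
hypothesis, Mathlib's `Matrix.IsElliptic`), by Shapiro's lemma and counting, and adds the exact dimension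
`dim_K H = 2 dim_ℂ S₂(Γ₀(N))` (`finrank_parEllCocycles_eq`), which the counting route gives and the factorisation
alone does not.

## References
* Ju. I. Manin, Parabolic points and zeta functions of modular curves (1972), Thm. 1.9 [Manin1972].
* G. Shimura, *Introduction to the arithmetic theory of automorphic functions* (1971), §8.1–8.2 [ShimuraIATAF1971].
* G. Wiese, Multiplicities of Galois representations of weight one, ANT 1 (2007), §2–3 [Wiese2007Multiplicities].
-/

-- justification: the `Summit.BirchSwinnertonDyer.BirchSwinnertonDyer.…` path repeats a component (route-file convention)
set_option linter.dupNamespace false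
set_option autoImplicit false

noncomputable section

open scoped MatrixGroups ModularForm

open CongruenceSubgroup Matrix.SpecialLinearGroup ModularGroup

open Literature.NumberTheory.EllipticCurves.ModularForms

namespace Summit.BirchSwinnertonDyer.BirchSwinnertonDyer.Theorems.SdTorsion

namespace ParabolicCountK

open _root_.Module _root_.LinearMap
open scoped Classical

variable {K : Type*} [Field K] {N : ℕ}

/-! ### Elliptic elements have vanishing periods -/

/-- **Cayley–Hamilton in `SL(2, ℤ)`**: `A² = (tr A)·A - 1`. [folklore] -/
theorem coe_mul_coe_eq_trace_smul_sub_one (A : SL(2, ℤ)) :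
    (A : Matrix (Fin 2) (Fin 2) ℤ) * A =
      (A : Matrix (Fin 2) (Fin 2) ℤ).trace • (A : Matrix (Fin 2) (Fin 2) ℤ) - 1 := by
  have hdet : (A : Matrix (Fin 2) (Fin 2) ℤ).det = 1 := A.det_coe
  rw [Matrix.det_fin_two] at hdet
  rw [Matrix.trace_fin_two]
  ext i j
  rw [Matrix.mul_apply, Fin.sum_univ_two, Matrix.sub_apply, Matrix.smul_apply, smul_eq_mul,
    Matrix.one_apply]
  fin_cases i <;> fin_cases j <;> simp <;>
    first
    | linear_combination (-1 : ℤ) * hdet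
    | ring

variable [NeZero N]

/-- `{∞, x∞} = 0` for `x ∈ Γ₀(N)` with `x = -1` (`x² = 1` and `S₂(Γ₀(N))^∨` has no `2`-torsion). [folklore] -/
theorem periodFunctional_eq_zero_of_coe_eq_neg_one {x : Gamma0 N} (hx : (x : SL(2, ℤ)) = -1) :
    periodFunctional N x = 0 := by
  have hxx : x * x = 1 := Subtype.ext (by simp [hx])
  have h := periodFunctional_mul N x x
  rw [hxx, periodFunctional_one, ← two_smul ℂ] at h
  exact (smul_eq_zero.mp h.symm).resolve_left two_ne_zero

/-- `{∞, x∞} = 0` when `x³ = ±1`-type relations give `3 · {∞, x∞} = 0`: auxiliary. [folklore] -/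
theorem periodFunctional_eq_zero_of_three {x : Gamma0 N}
    (h : periodFunctional N x + periodFunctional N x + periodFunctional N x = 0) :
    periodFunctional N x = 0 := by
  have h3 : (3 : ℂ) • periodFunctional N x = 0 := by
    rw [show (3 : ℂ) = 2 + 1 by norm_num, add_smul, two_smul, one_smul, h]
  exact (smul_eq_zero.mp h3).resolve_left three_ne_zero

/-- **Elliptic elements of `Γ₀(N)` have zero periods**: `{∞, γ∞}_h = 0` for every `h ∈ S₂(Γ₀(N))` if `γ` is
elliptic (`|tr γ| ≤ 1`, so `γ² = -1`, `γ³ = -1` or `γ³ = 1` by Cayley–Hamilton, and the period map is additive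
into the torsion-free group `S₂(Γ₀(N))^∨`). [folklore] -/
theorem periodFunctional_eq_zero_of_isElliptic {γ : Gamma0 N}
    (hγ : ((γ : SL(2, ℤ)) : Matrix (Fin 2) (Fin 2) ℤ).IsElliptic) : periodFunctional N γ = 0 := by
  set A : Matrix (Fin 2) (Fin 2) ℤ := ((γ : SL(2, ℤ)) : Matrix (Fin 2) (Fin 2) ℤ) with hA
  have hdet : A.det = 1 := (γ : SL(2, ℤ)).det_coe
  have hdisc : A.trace ^ 2 - 4 * A.det < 0 := by
    rw [← Matrix.discr_fin_two]
    exact hγ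
  rw [hdet] at hdisc
  have hsq := coe_mul_coe_eq_trace_smul_sub_one (γ : SL(2, ℤ))
  rw [← hA] at hsq
  have ht : A.trace = -1 ∨ A.trace = 0 ∨ A.trace = 1 := by
    have h1 : A.trace ≤ 1 := by nlinarith
    have h2 : -1 ≤ A.trace := by nlinarith
    omega
  -- the coercion `Γ₀(N) → SL(2, ℤ) → Matrix` of a product
  have hcoe3 : (((γ * γ * γ : Gamma0 N) : SL(2, ℤ)) : Matrix (Fin 2) (Fin 2) ℤ) = A * A * A := by
    simp [hA]
  have hcoe2 : (((γ * γ : Gamma0 N) : SL(2, ℤ)) : Matrix (Fin 2) (Fin 2) ℤ) = A * A := by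
    simp [hA]
  have hadd3 := periodFunctional_mul N (γ * γ) γ
  rw [periodFunctional_mul N γ γ] at hadd3
  rcases ht with ht | ht | ht
  · -- `tr γ = -1`: `γ² = -γ - 1`, `γ³ = 1`
    rw [ht, neg_one_zsmul] at hsq
    have hA3 : A * A * A = 1 := by
      rw [hsq, sub_mul, neg_mul, one_mul, hsq]
      abel
    have h3 : γ * γ * γ = 1 :=
      Subtype.ext (Subtype.ext (by rw [hcoe3, hA3]; simp))
    rw [h3, periodFunctional_one] at hadd3
    exact periodFunctional_eq_zero_of_three hadd3.symm
  · -- `tr γ = 0`: `γ² = -1`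
    rw [ht, zero_zsmul, zero_sub] at hsq
    have h2 : ((γ * γ : Gamma0 N) : SL(2, ℤ)) = -1 :=
      Subtype.ext (by rw [hcoe2, hsq]; simp)
    have h := periodFunctional_eq_zero_of_coe_eq_neg_one h2
    rw [periodFunctional_mul, ← two_smul ℂ] at h
    exact (smul_eq_zero.mp h).resolve_left two_ne_zero
  · -- `tr γ = 1`: `γ² = γ - 1`, `γ³ = -1`
    rw [ht, one_zsmul] at hsq
    have hA3 : A * A * A = -1 := by
      rw [hsq, sub_mul, one_mul, hsq]
      abel
    have h3 : ((γ * γ * γ : Gamma0 N) : SL(2, ℤ)) = -1 :=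
      Subtype.ext (by rw [hcoe3, hA3]; simp)
    have h := periodFunctional_eq_zero_of_coe_eq_neg_one h3
    rw [h] at hadd3
    exact periodFunctional_eq_zero_of_three hadd3.symm

/-! ### Parabolic–elliptic cocycles from additive functionals on the period homology -/

/-- **An additive functional `φ` on `Λ = periodHomology N` gives the parabolic–elliptic cocycle
`γ ↦ φ({∞, γ∞})`** (Manin's homomorphism property; parabolic and elliptic elements have zero periods).
[folklore] -/
theorem comp_periodFunctional_mem_parEllCocycles (φ : periodHomology N →+ K) :
    (fun γ : Gamma0 N ↦ φ ⟨periodFunctional N γ, periodFunctional_mem_periodHomology N γ⟩) ∈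
      parEllCocycles K N := by
  refine ⟨fun γ δ ↦ ?_, fun γ hγ ↦ ?_, fun γ hγ ↦ ?_⟩
  · show φ _ = φ _ + φ _
    rw [← map_add]
    congr 1
    apply Subtype.ext
    show periodFunctional N (γ * δ) = periodFunctional N γ + periodFunctional N δ
    exact periodFunctional_mul N γ δ
  · have h0 : (⟨periodFunctional N γ, periodFunctional_mem_periodHomology N γ⟩ : periodHomology N) = 0 :=
      Subtype.ext (periodFunctional_eq_zero_of_isParabolic hγ)
    simp only [h0, map_zero]
  · have h0 : (⟨periodFunctional N γ, periodFunctional_mem_periodHomology N γ⟩ : periodHomology N) = 0 :=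
      Subtype.ext (periodFunctional_eq_zero_of_isElliptic hγ)
    simp only [h0, map_zero]

end ParabolicCountK

open ParabolicCountK

variable {K : Type*} [Field K] {N : ℕ} [NeZero N]

open _root_.Module
open scoped Classical

/-- **The torsion Eichler–Shimura theorem / integral Manin exactness, for an arbitrary field `K`.**
For `N ≥ 1`, every `u : Γ₀(N) → K` which is additive and vanishes on the parabolic and on the elliptic
elements of `Γ₀(N)` is of the form `u(γ) = φ({∞, γ∞})` for an additive `φ : H₁(X₀(N), ℤ) = periodHomology N → K`.
(`K = 𝔽_ℓ`: `Hom(Λ/ℓΛ, 𝔽_ℓ) = Hom(Γ₀(N)/⟨±1, ell, par⟩, 𝔽_ℓ)`; `K = ℝ`: Eichler–Shimura.) Proof: the `n = 2g`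
integer-coordinate cocycles of a `ℤ`-basis of `Λ` (`periodHomology_eq_span_basis_holds`) are `K`-linearly
independent, and `dim_K H ≤ 2g` (`finrank_parEllCocycles_le_two_mul_finrank`, part III), so they span.
[cite: Manin1972, Thm. 1.9 (integral form, via Shimura §8.2 over an arbitrary field)] -/
theorem exists_addMonoidHom_periodHomology_eq (u : Gamma0 N → K)
    (hu : ∀ γ δ : Gamma0 N, u (γ * δ) = u γ + u δ)
    (hpar : ∀ γ : Gamma0 N, ((γ : SL(2, ℤ)) : Matrix (Fin 2) (Fin 2) ℤ).IsParabolic → u γ = 0)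
    (hell : ∀ γ : Gamma0 N, ((γ : SL(2, ℤ)) : Matrix (Fin 2) (Fin 2) ℤ).IsElliptic → u γ = 0) :
    ∃ φ : periodHomology N →+ K,
      ∀ γ : Gamma0 N, u γ = φ ⟨periodFunctional N γ, periodFunctional_mem_periodHomology N γ⟩ := by
  obtain ⟨n, b, hb⟩ := periodHomology_eq_span_basis_holds N
  -- `n = 2 dim_ℂ S₂(Γ₀(N))`
  have hn : n = 2 * finrank ℂ (CuspForm (Gamma0 N) 2) := by
    rw [← Subspace.dual_finrank_eq, ← finrank_real_of_complex, Module.finrank_eq_card_basis b,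
      Fintype.card_fin]
  -- integrality of the coordinates on `Λ`
  have hint : ∀ x : periodHomology N, ∀ i, ((⌊b.repr (x : Module.Dual ℂ (CuspForm (Gamma0 N) 2)) i⌋ : ℤ) : ℝ) =
      b.repr (x : Module.Dual ℂ (CuspForm (Gamma0 N) 2)) i := by
    intro x i
    have hx : (x : Module.Dual ℂ (CuspForm (Gamma0 N) 2)) ∈ Submodule.span ℤ (Set.range b) := by
      rw [← SetLike.mem_coe, ← hb]
      exact x.2
    obtain ⟨m, hm⟩ := (Module.Basis.mem_span_iff_repr_mem ℤ b _).mp hx i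
    rw [eq_intCast] at hm
    rw [← hm, Int.floor_intCast]
  -- the integer coordinate functionals `c i : Λ →+ ℤ`
  let c : Fin n → (periodHomology N →+ ℤ) := fun i ↦
    { toFun := fun x ↦ ⌊b.repr (x : Module.Dual ℂ (CuspForm (Gamma0 N) 2)) i⌋
      map_zero' := by simp
      map_add' := fun x y ↦ by
        apply Int.cast_injective (α := ℝ)
        rw [Int.cast_add, hint, hint, hint, AddSubgroup.coe_add, map_add, Finsupp.add_apply] }
  have hc : ∀ i (x : periodHomology N), ((c i x : ℤ) : ℝ) =
      b.repr (x : Module.Dual ℂ (CuspForm (Gamma0 N) 2)) i := fun i x ↦ hint x i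
  -- the coordinate cocycles `v i : γ ↦ c_i({∞, γ∞})`, as elements of `H = parEllCocycles K N`
  let ψ : Fin n → (periodHomology N →+ K) := fun i ↦ (Int.castAddHom K).comp (c i)
  let v : Fin n → parEllCocycles K N := fun i ↦
    ⟨fun γ ↦ ψ i ⟨periodFunctional N γ, periodFunctional_mem_periodHomology N γ⟩,
      comp_periodFunctional_mem_parEllCocycles (ψ i)⟩
  -- every basis vector `b j` is a period `{∞, γ_j∞}`
  have hbj : ∀ j, ∃ γ : Gamma0 N, periodFunctional N γ = b j := by
    intro j
    have hmem : b j ∈ (periodHomology N : Set (Module.Dual ℂ (CuspForm (Gamma0 N) 2))) := by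
      rw [hb]
      exact Submodule.subset_span ⟨j, rfl⟩
    rw [coe_periodHomology_eq_range] at hmem
    exact hmem
  choose γb hγb using hbj
  -- `c i (b j) = δ_{ij}`
  have hcb : ∀ i j, c i ⟨periodFunctional N (γb j), periodFunctional_mem_periodHomology N _⟩ =
      if i = j then 1 else 0 := by
    intro i j
    apply Int.cast_injective (α := ℝ)
    rw [hc]
    simp only [hγb, Module.Basis.repr_self]
    rw [Finsupp.single_apply]
    by_cases h : i = j
    · subst h; simp
    · simp [h, Ne.symm h]
  -- linear independence of the `v i`
  have hli : LinearIndependent K v := by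
    rw [Fintype.linearIndependent_iff]
    intro g hg j
    have h := congrArg (fun w : parEllCocycles K N ↦ (w : Gamma0 N → K) (γb j)) hg
    simp only [Submodule.coe_sum, Submodule.coe_smul, Finset.sum_apply, Pi.smul_apply, smul_eq_mul,
      Submodule.coe_zero, Pi.zero_apply] at h
    have hv : ∀ i, (v i : Gamma0 N → K) (γb j) = if i = j then 1 else 0 := by
      intro i
      change ((c i ⟨periodFunctional N (γb j), _⟩ : ℤ) : K) = _
      rw [hcb]
      split_ifs <;> simp
    simp only [hv, mul_ite, mul_one, mul_zero, Finset.sum_ite_eq', Finset.mem_univ, if_true] at h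
    exact h
  -- dimension count: the `v i` span `H`
  haveI := finite_parEllCocycles K N
  have hcard : Fintype.card (Fin n) = finrank K (parEllCocycles K N) := by
    apply le_antisymm (hli.fintype_card_le_finrank)
    rw [Fintype.card_fin, hn]
    exact finrank_parEllCocycles_le_two_mul_finrank K N
  have hspan := hli.span_eq_top_of_card_eq_finrank' hcard
  have hmem : (⟨u, ⟨hu, hpar, hell⟩⟩ : parEllCocycles K N) ∈ Submodule.span K (Set.range v) := by
    rw [hspan]
    exact Submodule.mem_top
  obtain ⟨a, ha⟩ := (Submodule.mem_span_range_iff_exists_fun K).mp hmem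
  -- the functional `φ = ∑ a_i ψ_i`
  refine ⟨AddMonoidHom.mk' (fun x ↦ ∑ i, a i * ψ i x) fun x y ↦ ?_, fun γ ↦ ?_⟩
  · simp only [map_add, mul_add, Finset.sum_add_distrib]
  · have h := congrArg (fun w : parEllCocycles K N ↦ (w : Gamma0 N → K) γ) ha
    simp only [Submodule.coe_sum, Submodule.coe_smul, Finset.sum_apply, Pi.smul_apply, smul_eq_mul] at h
    rw [AddMonoidHom.mk'_apply, ← h]

/-- **Equivalent kernel form**: an additive `u : Γ₀(N) → K` killing the parabolic and elliptic elements
vanishes on the kernel of Manin's period map — if `{∞, γ∞} = {∞, δ∞}` then `u(γ) = u(δ)`. [cite: Manin1972, Thm. 1.9] -/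
theorem eq_of_periodFunctional_eq (u : Gamma0 N → K)
    (hu : ∀ γ δ : Gamma0 N, u (γ * δ) = u γ + u δ)
    (hpar : ∀ γ : Gamma0 N, ((γ : SL(2, ℤ)) : Matrix (Fin 2) (Fin 2) ℤ).IsParabolic → u γ = 0)
    (hell : ∀ γ : Gamma0 N, ((γ : SL(2, ℤ)) : Matrix (Fin 2) (Fin 2) ℤ).IsElliptic → u γ = 0)
    {γ δ : Gamma0 N} (h : periodFunctional N γ = periodFunctional N δ) : u γ = u δ := by
  obtain ⟨φ, hφ⟩ := exists_addMonoidHom_periodHomology_eq u hu hpar hell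
  rw [hφ γ, hφ δ]
  exact congrArg φ (Subtype.ext h)

/-- **The dimension is exactly `2g`**: `dim_K H¹_{par, ell}(Γ₀(N), K) = 2 dim_ℂ S₂(Γ₀(N))` for every field `K`
(the `K`-linear span of the coordinate cocycles has dimension `2g`). [cite: ShimuraIATAF1971, §8.2 (8.2.23), over an arbitrary field] -/
theorem finrank_parEllCocycles_eq :
    finrank K (parEllCocycles K N) = 2 * finrank ℂ (CuspForm (Gamma0 N) 2) := by
  refine le_antisymm (finrank_parEllCocycles_le_two_mul_finrank K N) ?_
  obtain ⟨n, b, hb⟩ := periodHomology_eq_span_basis_holds N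
  have hn : n = 2 * finrank ℂ (CuspForm (Gamma0 N) 2) := by
    rw [← Subspace.dual_finrank_eq, ← finrank_real_of_complex, Module.finrank_eq_card_basis b,
      Fintype.card_fin]
  -- as in the main theorem: `n` independent coordinate cocycles
  have hint : ∀ x : periodHomology N, ∀ i, ((⌊b.repr (x : Module.Dual ℂ (CuspForm (Gamma0 N) 2)) i⌋ : ℤ) : ℝ) =
      b.repr (x : Module.Dual ℂ (CuspForm (Gamma0 N) 2)) i := by
    intro x i
    have hx : (x : Module.Dual ℂ (CuspForm (Gamma0 N) 2)) ∈ Submodule.span ℤ (Set.range b) := by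
      rw [← SetLike.mem_coe, ← hb]
      exact x.2
    obtain ⟨m, hm⟩ := (Module.Basis.mem_span_iff_repr_mem ℤ b _).mp hx i
    rw [eq_intCast] at hm
    rw [← hm, Int.floor_intCast]
  let c : Fin n → (periodHomology N →+ ℤ) := fun i ↦
    { toFun := fun x ↦ ⌊b.repr (x : Module.Dual ℂ (CuspForm (Gamma0 N) 2)) i⌋
      map_zero' := by simp
      map_add' := fun x y ↦ by
        apply Int.cast_injective (α := ℝ)
        rw [Int.cast_add, hint, hint, hint, AddSubgroup.coe_add, map_add, Finsupp.add_apply] }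
  have hc : ∀ i (x : periodHomology N), ((c i x : ℤ) : ℝ) =
      b.repr (x : Module.Dual ℂ (CuspForm (Gamma0 N) 2)) i := fun i x ↦ hint x i
  let ψ : Fin n → (periodHomology N →+ K) := fun i ↦ (Int.castAddHom K).comp (c i)
  let v : Fin n → parEllCocycles K N := fun i ↦
    ⟨fun γ ↦ ψ i ⟨periodFunctional N γ, periodFunctional_mem_periodHomology N γ⟩,
      comp_periodFunctional_mem_parEllCocycles (ψ i)⟩
  have hbj : ∀ j, ∃ γ : Gamma0 N, periodFunctional N γ = b j := by
    intro j
    have hmem : b j ∈ (periodHomology N : Set (Module.Dual ℂ (CuspForm (Gamma0 N) 2))) := by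
      rw [hb]
      exact Submodule.subset_span ⟨j, rfl⟩
    rw [coe_periodHomology_eq_range] at hmem
    exact hmem
  choose γb hγb using hbj
  have hcb : ∀ i j, c i ⟨periodFunctional N (γb j), periodFunctional_mem_periodHomology N _⟩ =
      if i = j then 1 else 0 := by
    intro i j
    apply Int.cast_injective (α := ℝ)
    rw [hc]
    simp only [hγb, Module.Basis.repr_self]
    rw [Finsupp.single_apply]
    by_cases h : i = j
    · subst h; simp
    · simp [h, Ne.symm h]
  have hli : LinearIndependent K v := by
    rw [Fintype.linearIndependent_iff]
    intro g hg j
    have h := congrArg (fun w : parEllCocycles K N ↦ (w : Gamma0 N → K) (γb j)) hg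
    simp only [Submodule.coe_sum, Submodule.coe_smul, Finset.sum_apply, Pi.smul_apply, smul_eq_mul,
      Submodule.coe_zero, Pi.zero_apply] at h
    have hv : ∀ i, (v i : Gamma0 N → K) (γb j) = if i = j then 1 else 0 := by
      intro i
      change ((c i ⟨periodFunctional N (γb j), _⟩ : ℤ) : K) = _
      rw [hcb]
      split_ifs <;> simp
    simp only [hv, mul_ite, mul_one, mul_zero, Finset.sum_ite_eq', Finset.mem_univ, if_true] at h
    exact h
  haveI := finite_parEllCocycles K N
  have h := hli.fintype_card_le_finrank
  rwa [Fintype.card_fin, hn] at h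

end Summit.BirchSwinnertonDyer.BirchSwinnertonDyer.Theorems.SdTorsion

end
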